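import Summits.AtomisticToContinuum.FouriersLaw.Theses.BondHeatUncertainty
import Summits.AtomisticToContinuum.FouriersLaw.Theorems.BondHeatUncertaintyDefs
import Literature.MathematicalPhysics.KineticTheory.LangevinChainReversal
import Literature.Probability.Entropy.FluctuationTheoremUncertainty

/-!
# Line `lebesgue-flip-duality` of crux ★ `BondHeatUncertainty.LinearResponseFTUR`: statements and lever

Support file for the crux item stmt-AtomisticToContinuum-9122 (route `BondHeatUncertainty`, sub
`FouriersLaw`). The seven stub STATEMENTS of the line as `Prop`s (`PathLebesgueDuality` K1,
`AntiDampedGirsanov` K3, `HeatFluxDetailedBalance` (GDB), `StationaryEntropyBalance` K4,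
`SteadyHeatRates`, `EquilibriumBondHeatVariance` K6a, `BondHeatVarianceContinuity` K6b,
`FiniteBiasClausius`), the lever `heatFluxDetailedBalance_of : K1 → K3 → (GDB)` (proved: the slot/sign
bookkeeping of time reversal ∘ momentum flip on the observable space), and the two composition
statements `TransferStatement`, `LineComposition` proved in `…LineComposition.lean`. The stubs themselves
are the landed files `…LinearResponseFTUR<Stub>.lean`; the crux is closed in
`Theorems/BondHeatUncertaintyLinearResponseFTUR.lean`.
-/

noncomputable section

namespace Summit.AtomisticToContinuum.FouriersLaw.Theorems.LinearResponseFTUR.Line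


open MeasureTheory ProbabilityTheory Filter Topology
open scoped NNReal ENNReal
open Literature.MathematicalPhysics.KineticTheory
open Literature.MathematicalPhysics.KineticTheory.HeatConduction
open Literature.Probability.Process
open Summit.AtomisticToContinuum.FouriersLaw.Theses.BondHeatUncertainty
open Summit.AtomisticToContinuum.FouriersLaw.Theorems.BondHeatUncertainty

/-! ## The stub statements

Statement texts are `let`-free (the ledger registers the text of each `stub_*` signature): the chain
is written `pinnedChain ω₂ lam β γ` at every occurrence, the bath sites and the bond are universally
quantified indices `i0 iN ib : Fin N` pinned by `i0.val = 0`, `iN.val = N - 1` (and `ib.val + 1 < N`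
where a real bond is needed), and the flux law is spelled `fluxLaw (pinnedChain ω₂ lam β γ) N i0 iN ib …`. -/

/-- **K1 — path-level Lebesgue duality (endpoint–work–bond-heat marginal).** For the pinned chain
(`N ≥ 2`, `t > 0`): `r_* R = e^{2γt} R̂` on the observables `(x_0, x_t, I_L, I_R, Q^b)` — under pure
time reversal the endpoints swap and the three integrals are invariant; `R = ∫dz P_z` the damped
chain from Lebesgue, `R̂ = ∫dy P̂_y` the reversed-drift chain from Lebesgue. The two-time case
(`G` depending on the endpoints only) is the tree's
`OscillatorChain.IsConfining.lintegral_langevinKernel_duality` (with `pinnedChain_isConfining` and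
`pinnedChain_langevinSolMap_eq_solMap` of `Theorems/BondHeatUncertaintySubdiffusiveBondHeatKernelGibbsA`);
the extension to the path functionals is the PATHWISE bijection `x ↦ Φ_t(x, B)` (Jacobian `e^{-2γt}`,
inverse = reversed flow driven by the reversed pair, which retraces the forward path:
`ConfinedFlowReversal.flow_reverse_eqOn`, `ConfinedFlowJacobian.lintegral_comp_flow_mul`,
`ConfinedDuality.sdeSolMap_pairRev_eq`, `BrownianPairReversal.map_pairRev_wienerPair`), so that the
three `ds`-integrals of state functions along the path are unchanged. -/
def PathLebesgueDuality : Prop :=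
  ∀ ω₂ lam β γ : ℝ, 0 < ω₂ → 0 < lam → 0 < β → 0 < γ →
  ∀ (N : ℕ) (i0 iN ib : Fin N), 2 ≤ N → i0.val = 0 → iN.val = N - 1 →
  ∀ (T_L T_R : ℝ), 0 < T_L → 0 < T_R → ∀ t : ℝ, 0 < t →
  ∀ G : Obs N → ℝ≥0∞, Measurable G →
    ∫⁻ z, ∫⁻ w, G (swapObs N (rawObs (pinnedChain ω₂ lam β γ) N i0 iN ib t z
        (fwdPath (pinnedChain ω₂ lam β γ) N T_L T_R z w))) ∂wienerPair =
      ENNReal.ofReal (Real.exp (2 * γ * t)) *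
        ∫⁻ y, ∫⁻ w, G (rawObs (pinnedChain ω₂ lam β γ) N i0 iN ib t y
          (revPath (pinnedChain ω₂ lam β γ) N T_L T_R y w)) ∂wienerPair

/-- **K3 — the anti-damped Girsanov formula (HARDEST stub).** For `N ≥ 2`, `t ≥ 0`, every `y` and
every measurable `F ≥ 0` on `Obs N`:
`e^{2γt} E[F(y, Θ X̂_t, -Î_L, -Î_R, -Q̂^b)] = E_y[exp(Q_L/T_L + Q_R/T_R) F(y, X_t, I_L, I_R, Q^b)]`,
where `X̂` is the reversed-drift path started at `Θ y` (so `Θ ∘ X̂` is the ANTI-damped chain from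
`y` driven by the flipped pair: friction `+γ p_b`, same Hamiltonian part; `I_i(Θ∘X̂) = -I_i(X̂)`,
`Q^b(Θ∘X̂) = -Q^b(X̂)` since `∂_{q_i}H` is even and `j_b` odd in the momenta) and `X` the damped path
from `y`. Content: `dP^{anti}_y/dP_y |_{F_t} = ℰ(Σ_b ∫ √(2γ/T_b) p_b dW_b)_t = e^{-2γt} exp(Σ_b Q_b/T_b)`
PATHWISE by the Itô energy identity at each bath site (`Q_b = Δ(p_b²/2) + I_b`, Itô term `γT_b dt`
inside `Δ(p_b²/2)`), a measurable function OF the observable. Lead's route (no general Girsanov):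
exact discrete Cameron–Martin for predictable triangular shifts of the Gaussian increment vector on a
damped / anti-damped splitting scheme driven by the dyadic skeleton of the pair, pathwise convergence
of both schemes (flow Lipschitz in the noise path), and the two-sided Fatou sandwich
`Z·P ≤ P^a`, `Z⁻¹·P^a ≤ P`, `Z⁻¹Z = 1` pathwise ⇒ `P^a = Z·P` (no true-martingale / non-explosion
input at the critical exponent). -/
def AntiDampedGirsanov : Prop :=
  ∀ ω₂ lam β γ : ℝ, 0 < ω₂ → 0 < lam → 0 < β → 0 < γ →
  ∀ (N : ℕ) (i0 iN ib : Fin N), 2 ≤ N → i0.val = 0 → iN.val = N - 1 →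
  ∀ (T_L T_R : ℝ), 0 < T_L → 0 < T_R → ∀ t : ℝ, 0 ≤ t →
  ∀ (y : PhaseSpace N) (F : Obs N → ℝ≥0∞), Measurable F →
    ENNReal.ofReal (Real.exp (2 * γ * t)) *
        ∫⁻ w, F (swapObs N (flipObs N (rawObs (pinnedChain ω₂ lam β γ) N i0 iN ib t (y.1, -y.2)
          (revPath (pinnedChain ω₂ lam β γ) N T_L T_R (y.1, -y.2) w)))) ∂wienerPair =
      ∫⁻ w, ENNReal.ofReal (Real.exp
          (leftHeat i0 (rawObs (pinnedChain ω₂ lam β γ) N i0 iN ib t y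
              (fwdPath (pinnedChain ω₂ lam β γ) N T_L T_R y w)) / T_L +
            rightHeat iN (rawObs (pinnedChain ω₂ lam β γ) N i0 iN ib t y
              (fwdPath (pinnedChain ω₂ lam β γ) N T_L T_R y w)) / T_R)) *
        F (rawObs (pinnedChain ω₂ lam β γ) N i0 iN ib t y
          (fwdPath (pinnedChain ω₂ lam β γ) N T_L T_R y w)) ∂wienerPair

/-- **C⁺ — the heat-flux detailed balance (GDB on the endpoint–heat marginal).** For `N ≥ 2`,
`t > 0` and measurable `F ≥ 0` on `Obs N`:
`∫dz E_z[F(Θ̃ · obs)] = ∫dz E_z[exp(Q_L/T_L + Q_R/T_R) F(obs)]`, i.e. `Θ̃_* R = e^{Σ_b Q_b/T_b} · R`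
on `σ(x_0, x_t, I_L, I_R, Q^b)`. DERIVED below from K1 + K3 (`heatFluxDetailedBalance_of`). At
`T_L = T_R = T` and against the Gibbs density it is `Θ`-detailed balance of the equal-temperature
kernel w.r.t. Gibbs (the input every line of this crux shares). It is the HYPOTHESIS of the
registered stubs `stub_entropyBalance` and `stub_finiteBiasClausius`. -/
def HeatFluxDetailedBalance : Prop :=
  ∀ ω₂ lam β γ : ℝ, 0 < ω₂ → 0 < lam → 0 < β → 0 < γ →
  ∀ (N : ℕ) (i0 iN ib : Fin N), 2 ≤ N → i0.val = 0 → iN.val = N - 1 →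
  ∀ (T_L T_R : ℝ), 0 < T_L → 0 < T_R → ∀ t : ℝ, 0 < t →
  ∀ F : Obs N → ℝ≥0∞, Measurable F →
    ∫⁻ z, ∫⁻ w, F (flipObs N (rawObs (pinnedChain ω₂ lam β γ) N i0 iN ib t z
        (fwdPath (pinnedChain ω₂ lam β γ) N T_L T_R z w))) ∂wienerPair =
      ∫⁻ z, ∫⁻ w, ENNReal.ofReal (Real.exp
          (leftHeat i0 (rawObs (pinnedChain ω₂ lam β γ) N i0 iN ib t z
              (fwdPath (pinnedChain ω₂ lam β γ) N T_L T_R z w)) / T_L +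
            rightHeat iN (rawObs (pinnedChain ω₂ lam β γ) N i0 iN ib t z
              (fwdPath (pinnedChain ω₂ lam β γ) N T_L T_R z w)) / T_R)) *
        F (rawObs (pinnedChain ω₂ lam β γ) N i0 iN ib t z
          (fwdPath (pinnedChain ω₂ lam β γ) N T_L T_R z w)) ∂wienerPair

/-- **K4 (conclusion) — the stationary entropy balance, Lebowitz–Spohn form.** Under weak-NESS
uniqueness, for every weak steady state `μ` of the `N`-site chain (`N ≥ 2`) at `T_L, T_R > 0` whose
snapshot irreversibility `KL(μ ‖ Θ_*μ)` is finite, the endpoint–heat law `P = fluxLaw … μ` of the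
stationary process on `[0, t]` and its `Θ̃`-image are mutually absolutely continuous with integrable
log-likelihood ratio, the two bath heats are integrable, and
`∫ log(dP/dΘ̃_*P) dP = KL(μ ‖ Θ_*μ) - E[Q_L]/T_L - E[Q_R]/T_R`.
Proof from (GDB) (the registered stub is the implication `HeatFluxDetailedBalance → …`): uniqueness
identifies `μ` with the Krylov–Bogoliubov state of the constructed kernels (probability, kernel-INVARIANT,
`μ ≪ Leb` with density `ρ`, `e^{ϑH} ∈ L¹`: `Theorems/…LinearResponseFTURNessFacts.ness_facts`);
`P = ρ(x_0)·R_obs` and, by (GDB), `Θ̃_*P = ρ(Θx_t)e^{W}·R_obs`, `W = Q_L/T_L + Q_R/T_R`, `R_obs` the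
(σ-finite) image of `Leb ⊗ Wiener`; so `P ≪ Θ̃_*P ⟺ P(ρ(Θx_t) = 0) = 0 ⟺ μ(ρ∘Θ = 0) = 0` (law of
`x_t` is `μ` by invariance) `⟺ μ ≪ Θ_*μ`, which `KL(μ‖Θ_*μ) ≠ ⊤` gives; the reverse direction is the same
condition (`Θ̃` is an involution); `llr = [log ρ(x_0) - log ρ(Θx_0)] + D - W` with
`D := f(x_0) - f(x_t)`, `f := log ρ∘Θ` (finite `μ`-a.e.); the first bracket is `llr(μ, Θ_*μ)(x_0)`,
integrable with mean `KL(μ‖Θ_*μ)` (Mathlib `klDiv_ne_top_iff`), `W` is integrable (moments); NO finite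
entropy of `ρ` is needed for `D`: `llr⁻ ∈ L¹(P)` always (`x log x ≥ -1/e`, `Θ̃_*P` finite), hence
`D⁻ ∈ L¹`; with the truncations `f_n = max(min(f,n),-n)` one has `E[f_n(x_0) - f_n(x_t)] = 0`
(invariance), `|f_n(x_0) - f_n(x_t)| ≤ |D|`, `(f_n(x_0) - f_n(x_t))⁻ ≤ D⁻`, so Fatou gives
`E D⁺ ≤ liminf E(f_n(x_0)-f_n(x_t))⁺ = liminf E(f_n(x_0)-f_n(x_t))⁻ ≤ E D⁻ < ∞`, and then dominated
convergence gives `E D = 0`. This is where the crux's `K` enters (`fturShape_false_without_K`). -/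
def StationaryEntropyBalance : Prop :=
  ∀ ω₂ lam β γ : ℝ, 0 < ω₂ → 0 < lam → 0 < β → 0 < γ →
  (∀ (N : ℕ) (T_L T_R : ℝ), 0 < T_L → 0 < T_R → ∀ μ ν : Measure (PhaseSpace N),
    (pinnedChain ω₂ lam β γ).IsSteadyState N T_L T_R μ →
    (pinnedChain ω₂ lam β γ).IsSteadyState N T_L T_R ν → μ = ν) →
  ∀ (N : ℕ) (i0 iN ib : Fin N), 2 ≤ N → i0.val = 0 → iN.val = N - 1 →
  ∀ (T_L T_R : ℝ), 0 < T_L → 0 < T_R → ∀ μ : Measure (PhaseSpace N),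
    (pinnedChain ω₂ lam β γ).IsSteadyState N T_L T_R μ →
    InformationTheory.klDiv μ (Measure.map (fun x : PhaseSpace N => (x.1, -x.2)) μ) ≠ ⊤ →
  ∀ t : ℝ, 0 < t →
    IsProbabilityMeasure (fluxLaw (pinnedChain ω₂ lam β γ) N i0 iN ib T_L T_R t μ) ∧
    fluxLaw (pinnedChain ω₂ lam β γ) N i0 iN ib T_L T_R t μ ≪
      (fluxLaw (pinnedChain ω₂ lam β γ) N i0 iN ib T_L T_R t μ).map (flipObs N) ∧
    (fluxLaw (pinnedChain ω₂ lam β γ) N i0 iN ib T_L T_R t μ).map (flipObs N) ≪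
      fluxLaw (pinnedChain ω₂ lam β γ) N i0 iN ib T_L T_R t μ ∧
    Integrable (llr (fluxLaw (pinnedChain ω₂ lam β γ) N i0 iN ib T_L T_R t μ)
      ((fluxLaw (pinnedChain ω₂ lam β γ) N i0 iN ib T_L T_R t μ).map (flipObs N)))
      (fluxLaw (pinnedChain ω₂ lam β γ) N i0 iN ib T_L T_R t μ) ∧
    Integrable (leftHeat i0) (fluxLaw (pinnedChain ω₂ lam β γ) N i0 iN ib T_L T_R t μ) ∧
    Integrable (rightHeat iN) (fluxLaw (pinnedChain ω₂ lam β γ) N i0 iN ib T_L T_R t μ) ∧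
    ∫ p, llr (fluxLaw (pinnedChain ω₂ lam β γ) N i0 iN ib T_L T_R t μ)
        ((fluxLaw (pinnedChain ω₂ lam β γ) N i0 iN ib T_L T_R t μ).map (flipObs N)) p
        ∂(fluxLaw (pinnedChain ω₂ lam β γ) N i0 iN ib T_L T_R t μ) =
      (InformationTheory.klDiv μ (Measure.map (fun x : PhaseSpace N => (x.1, -x.2)) μ)).toReal -
        (∫ p, leftHeat i0 p ∂(fluxLaw (pinnedChain ω₂ lam β γ) N i0 iN ib T_L T_R t μ)) / T_L -
        (∫ p, rightHeat iN p ∂(fluxLaw (pinnedChain ω₂ lam β γ) N i0 iN ib T_L T_R t μ)) / T_R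

/-- **Steady heat rates** (stationarity + energy balance at finite bias): under weak-NESS
uniqueness, in the weak steady state `μ` of the `N`-site chain (`N ≥ 2`) the mean heat absorbed
from the left bath on `[0, t]`, minus the mean heat absorbed from the right bath, and the mean heat
through EVERY real bond `(b, b+1)` all equal `t · J`, `J = totalCurrent(μ)/(N-1)`; and (fourth
conjunct, lead reshape) the mean work rate of the left thermostatted momentum against the force,
`⟨p_0 ∂_{q_0}H⟩_μ`, equals `J` — the injected-power form in which `FiniteBiasClausius` is concluded.
Proof: `μ` is the kernel-invariant Krylov–Bogoliubov state (`ness_facts`), so the law of `x_s` under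
`μ ⊗ W` is `μ` for every `s` (`…FlowLaws.pinnedChain_map_solMap_of_invariant`), `E[Δ(p_i²/2)] = 0` and,
by Fubini, `E[I_i] = t·μ(p_i ∂_{q_i}H)`, `E[Q^b] = t·μ(j_b)`; weak stationarity tested (with the energy
cut-off `χ(H/R)`, `R → ∞`, dominated convergence from the polynomial bounds × `e^{ϑH} ∈ L¹`) on
`p_0²/2` gives `μ(p_0∂_{q_0}H) = γ(T_L - μ(p_0²))`, on the block energies
`e_b = Σ_{i≤b}(p_i²/2 + U(q_i)) + Σ_{i<b}V + ½V(q_{b+1}-q_b)` (`L e_b = -j_b + γ(T_L - p_0²)`,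
`…BathBondReductionGenerator.pinnedChain_generator_siteEnergy` for `b = 0`) gives `μ(j_b) = γ(T_L - μ(p_0²))`
for every real bond, hence all equal `J`; symmetrically on the right (`bondCurrent N ⟨N-1,_⟩ = 0`). -/
def SteadyHeatRates : Prop :=
  ∀ ω₂ lam β γ : ℝ, 0 < ω₂ → 0 < lam → 0 < β → 0 < γ →
  (∀ (N : ℕ) (T_L T_R : ℝ), 0 < T_L → 0 < T_R → ∀ μ ν : Measure (PhaseSpace N),
    (pinnedChain ω₂ lam β γ).IsSteadyState N T_L T_R μ →
    (pinnedChain ω₂ lam β γ).IsSteadyState N T_L T_R ν → μ = ν) →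
  ∀ (N : ℕ) (i0 iN ib : Fin N), 2 ≤ N → i0.val = 0 → iN.val = N - 1 → ib.val + 1 < N →
  ∀ (T_L T_R : ℝ), 0 < T_L → 0 < T_R → ∀ μ : Measure (PhaseSpace N),
    (pinnedChain ω₂ lam β γ).IsSteadyState N T_L T_R μ →
  ∀ t : ℝ, 0 ≤ t →
    ∫ p, leftHeat i0 p ∂(fluxLaw (pinnedChain ω₂ lam β γ) N i0 iN ib T_L T_R t μ) =
      t * ((pinnedChain ω₂ lam β γ).totalCurrent μ / ((N : ℝ) - 1)) ∧
    ∫ p, rightHeat iN p ∂(fluxLaw (pinnedChain ω₂ lam β γ) N i0 iN ib T_L T_R t μ) =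
      -(t * ((pinnedChain ω₂ lam β γ).totalCurrent μ / ((N : ℝ) - 1))) ∧
    ∫ p, p.2.2.2.2 ∂(fluxLaw (pinnedChain ω₂ lam β γ) N i0 iN ib T_L T_R t μ) =
      t * ((pinnedChain ω₂ lam β γ).totalCurrent μ / ((N : ℝ) - 1)) ∧
    ∫ x, x.2 i0 * partialQ i0 ((pinnedChain ω₂ lam β γ).hamiltonian N) x ∂μ =
      (pinnedChain ω₂ lam β γ).totalCurrent μ / ((N : ℝ) - 1)

/-- **K6a — the equilibrium bond-heat variance is the crux's `V_N(b,t)`.** Under weak-NESS uniqueness,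
along a steady-state family, at EQUAL temperatures `T_L = T_R = T` (where the member `μ N T T` is the
Gibbs measure `gibbsMeasure N T` by `pinnedChain_isSteadyState_gibbsMeasure` + (U), hence invariant under
the constructed kernels — the Krylov–Bogoliubov measure is a weak steady state, `ness_facts`), for
`N ≥ 2`, a real bond `ib` and `t > 0`: the bond heat `Q_t = ∫₀ᵗ j_b(z_s) ds` along the stationary flow
is square integrable and `Var_T(Q_t) = V_N(b,t) = 2∫₀ᵗ(t-s)C_N(b,s)ds` (mean `t·μ_T(j_b) = 0`,
`pinnedChain_integral_bondCurrent_gibbsMeasure`; second moment by the two-time law of the flow from an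
invariant law `…BathBondReductionTwoTime.pinnedChain_integral_solMap_pair_of_invariant`, Fubini, the lag
identities `…FlowLaws.integral_integral_triangle_eq` / `setIntegral_square_lag_eq`; `s ↦ C_N(b,s)`
measurable and bounded on `[0,t]` by Cauchy–Schwarz + invariance — this is where the crux's iterated
Bochner / interval integrals are shown NOT to be junk, `fturShape_eq_zero_of_nonpos`). -/
def EquilibriumBondHeatVariance : Prop :=
  ∀ ω₂ lam β γ : ℝ, 0 < ω₂ → 0 < lam → 0 < β → 0 < γ →
  (∀ (N : ℕ) (T_L T_R : ℝ), 0 < T_L → 0 < T_R → ∀ μ ν : Measure (PhaseSpace N),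
    (pinnedChain ω₂ lam β γ).IsSteadyState N T_L T_R μ →
    (pinnedChain ω₂ lam β γ).IsSteadyState N T_L T_R ν → μ = ν) →
  ∀ μ : (N : ℕ) → ℝ → ℝ → Measure (PhaseSpace N),
    (∀ (N : ℕ) (T_L T_R : ℝ), 0 < T_L → 0 < T_R →
      (pinnedChain ω₂ lam β γ).IsSteadyState N T_L T_R (μ N T_L T_R)) →
  ∀ T : ℝ, 0 < T → ∀ (N : ℕ) (i0 iN ib : Fin N), 2 ≤ N → i0.val = 0 → iN.val = N - 1 →
    ib.val + 1 < N → ∀ t : ℝ, 0 < t →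
    MemLp (fun p : Obs N => p.2.2.2.2) 2 (fluxLaw (pinnedChain ω₂ lam β γ) N i0 iN ib T T t (μ N T T)) ∧
    variance (fun p : Obs N => p.2.2.2.2) (fluxLaw (pinnedChain ω₂ lam β γ) N i0 iN ib T T t (μ N T T)) =
      bondHeatVariance ω₂ lam β γ T N ib.val t

/-- **K6b — δ-continuity of the bond-heat variance.** Under weak-NESS uniqueness, along a steady-state
family at `T ± δ/2`, for `N ≥ 2`, a real bond `ib`, `t > 0`: the bond heat `Q_t` is square integrable
for small `δ ≠ 0` and `Var_δ(Q_t) → Var_0(Q_t)` as `δ → 0`, `δ ≠ 0`, the limit being the variance under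
the equal-temperature member `μ N T T` (`μ_δ ⇒ μ_T`: tightness from the `e^{ϑH}`-moments of the
Krylov–Bogoliubov measures — `pinnedChain_H2_of_pos` / `pinnedChain_lintegral_exp_hamiltonian_small` with
constants locally uniform in the temperatures —, closedness of the weak Fokker–Planck class under such
limits, uniqueness at `(T, T)`; continuity of the flow in the noise amplitudes `√(2γ(T ± δ/2))`,
`LangevinChainNoiseContinuity.pinnedChain_norm_chainFlow_sub_chainFlow_le`; uniform integrability of
`Q_t²` from `|j_b| ≤ C_ε e^{εH}` and (3.4) `lintegral_exp_mul_hamiltonian_pinnedChainSemigroup_le`).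
Shared by every finite-`δ` line of this crux. -/
def BondHeatVarianceContinuity : Prop :=
  ∀ ω₂ lam β γ : ℝ, 0 < ω₂ → 0 < lam → 0 < β → 0 < γ →
  (∀ (N : ℕ) (T_L T_R : ℝ), 0 < T_L → 0 < T_R → ∀ μ ν : Measure (PhaseSpace N),
    (pinnedChain ω₂ lam β γ).IsSteadyState N T_L T_R μ →
    (pinnedChain ω₂ lam β γ).IsSteadyState N T_L T_R ν → μ = ν) →
  ∀ μ : (N : ℕ) → ℝ → ℝ → Measure (PhaseSpace N),
    (∀ (N : ℕ) (T_L T_R : ℝ), 0 < T_L → 0 < T_R →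
      (pinnedChain ω₂ lam β γ).IsSteadyState N T_L T_R (μ N T_L T_R)) →
  ∀ T : ℝ, 0 < T → ∀ (N : ℕ) (i0 iN ib : Fin N), 2 ≤ N → i0.val = 0 → iN.val = N - 1 →
    ib.val + 1 < N → ∀ t : ℝ, 0 < t →
    (∀ᶠ δ in 𝓝[≠] (0 : ℝ), MemLp (fun p : Obs N => p.2.2.2.2) 2
      (fluxLaw (pinnedChain ω₂ lam β γ) N i0 iN ib (T + δ / 2) (T - δ / 2) t
        (μ N (T + δ / 2) (T - δ / 2)))) ∧
    Tendsto (fun δ : ℝ => variance (fun p : Obs N => p.2.2.2.2)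
        (fluxLaw (pinnedChain ω₂ lam β γ) N i0 iN ib (T + δ / 2) (T - δ / 2) t
          (μ N (T + δ / 2) (T - δ / 2)))) (𝓝[≠] 0)
      (𝓝 (variance (fun p : Obs N => p.2.2.2.2)
        (fluxLaw (pinnedChain ω₂ lam β γ) N i0 iN ib T T t (μ N T T))))

/-- **Finite-bias Clausius inequality, injected-power form** (clause (a) before the limit): under
weak-NESS uniqueness, in the weak steady state `μ` of the `N`-site chain (`N ≥ 2`) at `T_L, T_R > 0` the
mean work rate of the left thermostatted momentum has the sign of `T_L - T_R`:
`0 ≤ (T_L - T_R)·⟨p_0 ∂_{q_0}H⟩_μ` (`= (T_L - T_R)·J` by the fourth conjunct of `SteadyHeatRates`). The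
registered stub is the IMPLICATION from (GDB): against the Gibbs density `ρ_{T_R} ∝ e^{-H/T_R}` (a
`Θ`-invariant TRANSIENT start, positive everywhere) (GDB) gives
`d(Θ̃_*P^ν)/dP^ν = ρ_{T_R}(x_t)/ρ_{T_R}(x_0)·e^{Q_L/T_L+Q_R/T_R} = e^{-(Q_L+Q_R)/T_R}e^{Q_L/T_L+Q_R/T_R}`
(pathwise energy balance `H(x_t) - H(x_0) = Q_L + Q_R`, `LangevinChainEnergyIdentity.pinnedChain_hamiltonian_chainFlow_eq`,
two distinct bath sites since `N ≥ 2`), i.e. `Σ^ν_t = Q_L(1/T_R - 1/T_L)` with NO density term, so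
`0 ≤ KL(P^ν‖Θ̃_*P^ν) = (1/T_R - 1/T_L)·E_ν[Q_{L,t}]` for every `t ≥ 0`; then
`E_ν[Q_{L,t}] = E_ν[Δ(p_0²/2)] + ∫₀ᵗ (νP_s)(p_0∂_{q_0}H) ds` with `E_ν[p_0(t)²]` bounded in `t` ((3.4) + H2)
and `(1/t)∫₀ᵗ νP_s ds ⇒ μ` (Krylov–Bogoliubov–Cesàro, `Literature.Probability.Process.KrylovBogoliubovCesaro`:
tightness from uniform `e^{ϑH}`-moments, limit points invariant ⇒ weak steady states
`pinnedChain_isSteadyState_of_isInvariant` ⇒ `= μ` by (U); uniform integrability of `p_0∂_{q_0}H`), hence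
`0 ≤ (1/T_R - 1/T_L)·⟨p_0∂_{q_0}H⟩_μ`, i.e. the claim. -/
def FiniteBiasClausius : Prop :=
  ∀ ω₂ lam β γ : ℝ, 0 < ω₂ → 0 < lam → 0 < β → 0 < γ →
  (∀ (N : ℕ) (T_L T_R : ℝ), 0 < T_L → 0 < T_R → ∀ μ ν : Measure (PhaseSpace N),
    (pinnedChain ω₂ lam β γ).IsSteadyState N T_L T_R μ →
    (pinnedChain ω₂ lam β γ).IsSteadyState N T_L T_R ν → μ = ν) →
  ∀ (N : ℕ) (i0 : Fin N), 2 ≤ N → i0.val = 0 →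
  ∀ (T_L T_R : ℝ), 0 < T_L → 0 < T_R → ∀ μ : Measure (PhaseSpace N),
    (pinnedChain ω₂ lam β γ).IsSteadyState N T_L T_R μ →
    0 ≤ (T_L - T_R) * ∫ x, x.2 i0 * partialQ i0 ((pinnedChain ω₂ lam β γ).hamiltonian N) x ∂μ

/-! ## The lever composes as typed: K1 + K3 ⇒ (GDB) on the marginal -/

/-- **(GDB) from K1 and K3.** `Θ̃_* R = Θ_*(r_* R) = e^{2γt} Θ_* R̂` (K1), `Θ_* R̂ = ∫dy (law of Θ∘X̂
from Θy)` (Lebesgue is `Θ`-invariant, `measurePreserving_momentumReversal`) `= ∫dy e^{-2γt}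
e^{Σ_b Q_b/T_b} P_y` (K3). Kernel-checked here: the slot/sign bookkeeping of the typed K1, K3
(endpoint swap, `Θ`, the parities of `I_L, I_R, Q^b`) is exactly right. -/
theorem heatFluxDetailedBalance_of (h1 : PathLebesgueDuality) (h3 : AntiDampedGirsanov) :
    HeatFluxDetailedBalance := by
  intro ω₂ lam β γ hω hl hβ hγ N i0 iN ib hN hi0 hiN T_L T_R hTL hTR t ht F hF
  set P := pinnedChain ω₂ lam β γ with hP
  have hG : Measurable fun p : Obs N => F (flipObs N (swapObs N p)) :=
    hF.comp ((measurable_flipObs N).comp (measurable_swapObs N))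
  -- K1 applied to `F ∘ Θ̃ ∘ r` (note `r ∘ r = id` definitionally on `rawObs`)
  have step1 :
      ∫⁻ z, ∫⁻ w, F (flipObs N (rawObs P N i0 iN ib t z (fwdPath P N T_L T_R z w))) ∂wienerPair =
        ENNReal.ofReal (Real.exp (2 * γ * t)) *
          ∫⁻ y, ∫⁻ w, F (flipObs N (swapObs N
            (rawObs P N i0 iN ib t y (revPath P N T_L T_R y w)))) ∂wienerPair :=
    h1 ω₂ lam β γ hω hl hβ hγ N i0 iN ib hN hi0 hiN T_L T_R hTL hTR t ht _ hG
  -- K3 at the flipped starting point (note `Θ̃ ∘ r = r ∘ Θ̃` definitionally)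
  have step3 : ∀ y : PhaseSpace N,
      ENNReal.ofReal (Real.exp (2 * γ * t)) *
          ∫⁻ w, F (flipObs N (swapObs N (rawObs P N i0 iN ib t (momentumReversal N y)
            (revPath P N T_L T_R (momentumReversal N y) w)))) ∂wienerPair =
        ∫⁻ w, ENNReal.ofReal (Real.exp
            (leftHeat i0 (rawObs P N i0 iN ib t y (fwdPath P N T_L T_R y w)) / T_L +
              rightHeat iN (rawObs P N i0 iN ib t y (fwdPath P N T_L T_R y w)) / T_R)) *
          F (rawObs P N i0 iN ib t y (fwdPath P N T_L T_R y w)) ∂wienerPair :=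
    fun y => h3 ω₂ lam β γ hω hl hβ hγ N i0 iN ib hN hi0 hiN T_L T_R hTL hTR t ht.le y F hF
  rw [step1, ← lintegral_const_mul' _ _ ENNReal.ofReal_ne_top]
  -- substitute `y ↦ Θ y` in the outer Lebesgue integral, then K3 pointwise
  refine (MeasurePreserving.lintegral_map_equiv _ (momentumReversal N)
    (measurePreserving_momentumReversal N)).trans ?_
  exact lintegral_congr step3

/-! ## Transfer and composition -/

/-- The TRANSFER statement `C⁺ ⇒ ★` of the line (an implication, packaged as one `Prop` so that the
only theorem of this file whose conclusion is headed by the crux name is `LinearResponseFTUR_of`). -/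
def TransferStatement : Prop :=
  HeatFluxDetailedBalance → (HeatFluxDetailedBalance → StationaryEntropyBalance) → SteadyHeatRates →
    EquilibriumBondHeatVariance → BondHeatVarianceContinuity →
    (HeatFluxDetailedBalance → FiniteBiasClausius) →
    Summit.AtomisticToContinuum.FouriersLaw.Theses.BondHeatUncertainty.LinearResponseFTUR

/-- The COMPOSITION statement of the line: the seven stub statements imply the crux. -/
def LineComposition : Prop :=
  PathLebesgueDuality → AntiDampedGirsanov → (HeatFluxDetailedBalance → StationaryEntropyBalance) →
    SteadyHeatRates → EquilibriumBondHeatVariance → BondHeatVarianceContinuity →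
    (HeatFluxDetailedBalance → FiniteBiasClausius) →
    Summit.AtomisticToContinuum.FouriersLaw.Theses.BondHeatUncertainty.LinearResponseFTUR

/-- **The lever `K1 → K3 → (GDB)`** — registered sub-goal form of `heatFluxDetailedBalance_of`. -/
theorem gdb_of_duality_and_girsanov :
    PathLebesgueDuality → AntiDampedGirsanov → HeatFluxDetailedBalance :=
  heatFluxDetailedBalance_of

end Summit.AtomisticToContinuum.FouriersLaw.Theorems.LinearResponseFTUR.Line

end
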